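import Summits.BirchSwinnertonDyer.BirchSwinnertonDyer.Theorems.PrintCf2SplitBadTwoLocalControlKernelDyadicTable
import Literature.NumberTheory.EllipticCurves.Agboola2007.RestrictedSelmerGroups
import HarnessLib

/-!
# Crux `PrintCf2.SplitBadTwoRankOneOfFacts` (stmt-BirchSwinnertonDyer-20368), road α v10.3 — brick B15 file 15: (R-DYADIC) ⟸ (R2) ∧ (C3-ψ) —
# the LEAD's `hDy` VERBATIM from the named class-field-theoretic fact (R2) and ONE Galois-module statement about `W*`

Cell `bsd-print-cf2`, width seat `bsd-line-cf2-p1-w2` g9 (prover-bsd-line-cf2-p1-w2-g9-0); brick B15 (memo `Cruxes/SplitBadTwoRankOneOfFacts/B15-DYADIC-EXACT-w2g9.md`);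
`--supports stmt-BirchSwinnertonDyer-20368` (helper, Theses-free). HONEST FRAMING: CONDITIONAL on the displayed hypotheses — (R2) is the tree's NAMED,
UNPROVED fact `ZpExtension.existsUnique_isUnramifiedOutside_of_split` (global class field theory: the `ℤ₂`-extension of an imaginary quadratic `K`
unramified outside one of the two places above a split `2` exists and is unique), (C3-ψ) is displayed, not proved. Nothing here closes the crux or a
registered stub; BSD is not proved by any of this; no summit statement is proved by this seat. No definition, no new named fact, no `sorry`.

WHAT. The residual (R-DYADIC) of LEAD g12's cuts (`hDy` of `restrictedControl_two_of_residuals_noC1`: `∃ ev, ∀` S3c frame, `∀ κ'` unramified outside `v̄`,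
`v₂ #LK_{v̄} = ev (d % 2) ((d / (2 − d % 2)) % 8)`) is NOT class-field-theory-free: it quantifies over every `ℤ₂`-line unramified outside `v̄`. This file
makes its exact remaining content explicit:
* **`exists_ev_padicValNat_natCard_localKer_vbar_of_unique_of_character`** — `hDy` VERBATIM from
  (R2) `ZpExtension.existsUnique_isUnramifiedOutside_of_split` and
  (C3-ψ) «on every S3c frame there is SOME `κ₀ : ZpExtension K 2` unramified outside `v̄` whose kernel meets `D_{v̄}` in the elements acting on
  `W* = E[𝔮_r^∞]` as `+1` or as `−1`» — the character `ψ_{W*} : Γ_K → ℤ₂ˣ` modulo `±1` (inertia at `v` acts through `±1` by the pinning clause, inertia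
  at `w | 7` through a finite subgroup of `ℤ₂ˣ`, i.e. through `±1`; elsewhere `W*` is unramified) — a pure Galois-module statement, the typing /
  proving target left in this lane ((R-CFT) of the LEAD's board; no `ZpExtension` has yet been CONSTRUCTED anywhere in the tree).
  Proof: (R2) at (`v̄`, `v`) makes `ker κ' = ker κ₀`, so (C3-loc) transfers to `κ'`, and file 13 (`exists_ev_padicValNat_natCard_localKer_vbar_of_kerC3`) applies.
presearch: [Agboola2007] §1 p. 1; [deShalit1987] II.4.17; K. Müller arXiv:2002.05647 §1 (the (R2) sources, held); no new fact filed. beyond-print theorem: no.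

References: [Agboola2007] §1, §3 Prop. 3.2, §6; [deShalit1987] II.4.17; [Rubin1999] §3 Lemma 3.6 (ii), Cor. 3.17.
-/

noncomputable section

open scoped Classical

set_option linter.dupNamespace false
set_option autoImplicit false

namespace Summit.BirchSwinnertonDyer.BirchSwinnertonDyer.Theorems.PrintCf2.RestrictedSelmerPair

open NumberField IsDedekindDomain Field WeierstrassCurve
open Literature.NumberTheory.EllipticCurves Literature.NumberTheory.EllipticCurves.GreenbergSelmer
open Literature.NumberTheory.GaloisRepresentations
open Summit.BirchSwinnertonDyer.BirchSwinnertonDyer.Theorems.PrintCf2.AdditiveAtSeven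
open Summit.BirchSwinnertonDyer.BirchSwinnertonDyer.Theorems.PrintCf2.CMPrimes


/-- **(R-DYADIC) ⟸ (R2) ∧ (C3-ψ)**: LEAD g12's `hDy` verbatim from the named fact (R2) (existence and uniqueness of the `ℤ₂`-line unramified outside `v̄`)
and the Galois-module statement (C3-ψ) (some `ℤ₂`-line unramified outside `v̄` has kernel meeting `D_{v̄}` in the elements acting on `W*` as `±1`).
CONDITIONAL on both displayed hypotheses. [cite: Agboola2007, §1 p. 1 and §3 Prop. 3.2] [cite: deShalit1987, II.4.17] -/
theorem exists_ev_padicValNat_natCard_localKer_vbar_of_unique_of_character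
    (hR2 : ZpExtension.existsUnique_isUnramifiedOutside_of_split)
    (hψ : ∀ (d : ℤ), d ≠ 0 → Squarefree d → d % 4 ≠ 1 →
      ∀ (W : WeierstrassCurve ℚ) [W.IsElliptic] (C : VariableChange ℚ), C • W = cm7.quadraticTwist (d : ℚ) →
      ∀ (L : Type) [Field L] [NumberField L], IsImaginaryQuadratic L →
      ∀ (v vbar : HeightOneSpectrum (𝓞 L)),
        ((2 : ℕ) : 𝓞 L) ∈ v.asIdeal → ((2 : ℕ) : 𝓞 L) ∈ vbar.asIdeal → vbar ≠ v →
      ∀ (π : (W.baseChange L).endRing), (π : AddMonoid.End (W.baseChange L).geomPoints) * π = π - 2 →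
      ∀ (r : ℤ_[2]), r * r = r - 2 →
        (∀ τ ∈ GreenbergSelmer.inertia v, ∀ x : ↥((W.baseChange L).endEigenPrimaryTorsion 2 π r), τ • x = x ∨ τ • x = -x) →
        ∃ κ₀ : ZpExtension L 2, κ₀.IsUnramifiedOutside vbar ∧
          ∀ σ ∈ decomp vbar, σ ∈ κ₀.kerSubgroup ↔
            ((∀ x : ↥((W.baseChange L).endEigenPrimaryTorsion 2 π r), σ • x = x) ∨ (∀ x : ↥((W.baseChange L).endEigenPrimaryTorsion 2 π r), σ • x = -x))) :
    ∃ ev : ℤ → ℤ → ℤ, ∀ (d : ℤ), d ≠ 0 → Squarefree d → d % 4 ≠ 1 →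
      ∀ (W : WeierstrassCurve ℚ) [W.IsElliptic] (C : VariableChange ℚ), C • W = cm7.quadraticTwist (d : ℚ) →
      ∀ (L : Type) [Field L] [NumberField L], IsImaginaryQuadratic L →
      ∀ (v vbar : HeightOneSpectrum (𝓞 L)),
        ((2 : ℕ) : 𝓞 L) ∈ v.asIdeal → ((2 : ℕ) : 𝓞 L) ∈ vbar.asIdeal → vbar ≠ v →
      ∀ (π : (W.baseChange L).endRing), (π : AddMonoid.End (W.baseChange L).geomPoints) * π = π - 2 →
      ∀ (r : ℤ_[2]), r * r = r - 2 →
        (∀ τ ∈ GreenbergSelmer.inertia v, ∀ x : ↥((W.baseChange L).endEigenPrimaryTorsion 2 π r), τ • x = x ∨ τ • x = -x) →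
      ∀ (κ' : ZpExtension L 2), κ'.IsUnramifiedOutside vbar →
        (padicValNat 2 (Nat.card (resOfLe ↥((W.baseChange L).endEigenPrimaryTorsion 2 π r)
          (inf_le_inf_right (decomp vbar) (le_top : κ'.kerSubgroup ≤ ⊤))).ker) : ℤ) = ev (d % 2) ((d / (2 - d % 2)) % 8) := by
  haveI : Fact (Nat.Prime 2) := ⟨Nat.prime_two⟩
  obtain ⟨ev, hev⟩ := exists_ev_padicValNat_natCard_localKer_vbar_of_kerC3
  refine ⟨ev, ?_⟩
  intro d hd0 hsq hd4 W _ C hC L _ _ hL v vbar hv hvbar hne π hrel r hr hclause κ' hκ'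
  obtain ⟨κ₀, hκ₀, hC3₀⟩ := hψ d hd0 hsq hd4 W C hC L hL v vbar hv hvbar hne π hrel r hr hclause
  -- (R2) at (`v̄`, `v`): the kernels agree
  have hker : κ'.kerSubgroup = κ₀.kerSubgroup := (hR2 2 L hL vbar v hvbar hv hne.symm).2 κ₀ κ' hκ₀ hκ'
  exact hev d hd0 hsq hd4 W C hC L hL v vbar hv hvbar hne π hrel r hr hclause κ' hκ' fun σ hσ ↦ by
    rw [hker]; exact hC3₀ σ hσ

end Summit.BirchSwinnertonDyer.BirchSwinnertonDyer.Theorems.PrintCf2.RestrictedSelmerPair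

end
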